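import Mathlib.Algebra.MvPolynomial.Eval
import Mathlib.Algebra.Order.Antidiag.FinsuppEquiv
import Mathlib.Algebra.Polynomial.BigOperators
import Mathlib.Algebra.Polynomial.Degree.Lemmas
import Mathlib.Algebra.Polynomial.Roots
import Mathlib.Data.Finsupp.Option
import Mathlib.Data.Nat.Sqrt
import Mathlib.LinearAlgebra.FiniteDimensional.Lemmas
import Mathlib.RingTheory.MvPolynomial.Basic
import HarnessLib

/-!
# Low-degree surfaces through a finite set of lines (Kollár 2015, Lemma 10 (1))

Topic `Literature/Combinatorics/Extremal` (the polynomial method in incidence geometry; the first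
step of the Guth–Katz / Kollár bound on line–line intersections in three dimensions, hence of
Rudnev's point–plane theorem and of the Stevens–de Zeeuw point–line bound
`Literature.Combinatorics.Additive.stevensDeZeeuw_thm4`). Everything here is PROVED.

J. Kollár, *Szemerédi–Trotter-type theorems in dimension 3*, Adv. Math. 271 (2015) 30–61,
§ "Low degree surfaces", **Lemma 10 (1)**: "Let `𝓛` be `m` distinct lines in `ℙ³`. There is a
surface `S` of degree `d ≤ √(6m) − 2` that contains `[𝓛]`", with the printed proof: "Degree `d`
homogeneous polynomials in 4 variables form a vector space of dimension `C(d+3, 3)`. For a surface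
of degree `d` it is `d + 1` linear conditions to contain a line. Thus if `C(d+3,3) > m(d+1)` then
such a surface exists."

We formalize the affine form over an arbitrary field and in any number `n` of variables: lines are
given parametrically, `t ↦ a + t v` (`a v : σ → 𝔽`), a polynomial `P` *contains* the line when
its restriction `P(a + t v) ∈ 𝔽[t]` (the substitution `Xᵢ ↦ aᵢ + vᵢ t`, `MvPolynomial.aeval`) is
the zero polynomial, and the parameter count is exactly the printed one:

* `exists_mvPolynomial_vanishing_on_lines` — if `m (d + 1) < C(d + n, n)` there is a nonzero
  `P` of total degree `≤ d` in `n = |σ|` variables whose restriction to each of the `m` given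
  lines vanishes (`C(d+n, n) = dim {P : deg P ≤ d}`, `d + 1` linear conditions per line).
* `exists_surface_through_lines` — the case `n = 3` with the explicit degree `d = ⌊√(6m)⌋`
  (for which `(d+3)(d+2) > 6m`, i.e. `C(d+3,3) > m(d+1)`). (The printed bound "`√(6m) − 2`"
  is not literally attainable for small `m` — e.g. `m = 2` skew lines need a quadric — and
  Kollár's own count gives exactly `(d+3)(d+2) > 6m`; every application uses only `d = O(√m)`.)

together with the two facts about restrictions to lines that every application needs
(Bézout on a line):

* `natDegree_aeval_line_le` — `deg_t P(a + t v) ≤ deg P`; `eval_aeval_line` — evaluation;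
* `aeval_line_eq_zero_of_totalDegree_lt_card` — a polynomial of degree `≤ d` vanishing at
  more than `d` points of a line contains the line;
* `card_filter_eval_line_eq_zero_le` — a line not contained in `{P = 0}` meets it in at most
  `deg P` points.

## References
* [Kollar2015] J. Kollár, Adv. Math. 271 (2015) 30–61, doi:10.1016/j.aim.2014.11.014,
  arXiv:1405.2243 — Lemma 10 (1) and its proof (§ Low degree surfaces).
-/

namespace Literature.Combinatorics.Extremal

open MvPolynomial Finset

section Restriction

variable {F : Type*} [CommRing F] {σ : Type*}

/-- The restriction of `P` to a line has degree at most the total degree of `P`.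
[cite: Kollar2015, Lemma 10 (proof: "d + 1 linear conditions to contain a line")] -/
theorem natDegree_aeval_line_le (a v : σ → F) (P : MvPolynomial σ F) :
    (MvPolynomial.aeval (fun i => Polynomial.C (a i) + Polynomial.C (v i) * Polynomial.X)
      P).natDegree ≤ P.totalDegree := by
  rw [MvPolynomial.aeval_eq_eval₂Hom, MvPolynomial.coe_eval₂Hom, MvPolynomial.eval₂_eq]
  refine Polynomial.natDegree_sum_le_of_forall_le _ _ fun s hs => ?_
  refine Polynomial.natDegree_mul_le.trans ?_
  rw [Polynomial.algebraMap_eq, Polynomial.natDegree_C, zero_add]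
  refine (Polynomial.natDegree_prod_le _ _).trans ?_
  have h1 : ∀ i, (Polynomial.C (a i) + Polynomial.C (v i) * Polynomial.X).natDegree ≤ 1 := by
    intro i
    refine (Polynomial.natDegree_add_le _ _).trans (max_le ?_ ?_)
    · rw [Polynomial.natDegree_C]
      exact Nat.zero_le _
    · exact (Polynomial.natDegree_C_mul_le _ _).trans Polynomial.natDegree_X_le
  calc ∑ i ∈ s.support, ((Polynomial.C (a i) + Polynomial.C (v i) * Polynomial.X) ^ s i).natDegree
      ≤ ∑ i ∈ s.support, s i := by
        refine Finset.sum_le_sum fun i _ => ?_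
        exact Polynomial.natDegree_pow_le.trans
          ((Nat.mul_le_mul_left _ (h1 i)).trans (mul_one _).le)
    _ ≤ P.totalDegree := MvPolynomial.le_totalDegree hs

/-- Evaluating the restriction at `t` is evaluating `P` at the point `a + t v`. [folklore] -/
theorem eval_aeval_line (a v : σ → F) (P : MvPolynomial σ F) (t : F) :
    (MvPolynomial.aeval (fun i => Polynomial.C (a i) + Polynomial.C (v i) * Polynomial.X)
      P).eval t = MvPolynomial.eval (a + t • v) P := by
  induction P using MvPolynomial.induction_on with
  | C c => simp
  | add p q hp hq => simp only [map_add, Polynomial.eval_add, hp, hq]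
  | mul_X p i hp =>
    simp only [map_mul, MvPolynomial.aeval_X, Polynomial.eval_mul, hp, MvPolynomial.eval_X,
      Polynomial.eval_add, Polynomial.eval_C, Polynomial.eval_X, Pi.add_apply, Pi.smul_apply,
      smul_eq_mul]
    ring

/-- **Vanishing on a line**: a polynomial of total degree `< |T|` vanishing at the points
`a + t v`, `t ∈ T`, of a line contains the line (its restriction is the zero polynomial).
[cite: Kollar2015, Lemma 10 (proof)] -/
theorem aeval_line_eq_zero_of_totalDegree_lt_card [IsDomain F] (a v : σ → F)
    (P : MvPolynomial σ F) (T : Finset F) (hT : P.totalDegree < T.card)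
    (h0 : ∀ t ∈ T, MvPolynomial.eval (a + t • v) P = 0) :
    MvPolynomial.aeval (fun i => Polynomial.C (a i) + Polynomial.C (v i) * Polynomial.X) P = 0 :=
  Polynomial.eq_zero_of_natDegree_lt_card_of_eval_eq_zero' _ T
    (fun t ht => by rw [eval_aeval_line]; exact h0 t ht)
    ((natDegree_aeval_line_le a v P).trans_lt hT)

/-- **Bézout on a line**: a line not contained in the zero set of `P` meets it in at most
`deg P` of the points `a + t v`, `t ∈ T`. [folklore] -/
theorem card_filter_eval_line_eq_zero_le [IsDomain F] [DecidableEq F] (a v : σ → F)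
    (P : MvPolynomial σ F) (T : Finset F)
    (hP : MvPolynomial.aeval
      (fun i => Polynomial.C (a i) + Polynomial.C (v i) * Polynomial.X) P ≠ 0) :
    (T.filter fun t => MvPolynomial.eval (a + t • v) P = 0).card ≤ P.totalDegree := by
  refine le_trans (Polynomial.card_le_degree_of_subset_roots fun t ht => ?_)
    (natDegree_aeval_line_le a v P)
  rw [Finset.mem_val, Finset.mem_filter] at ht
  rw [Polynomial.mem_roots hP, Polynomial.IsRoot.def, eval_aeval_line]
  exact ht.2

end Restriction

section Interpolation

variable {F : Type*} [Field F] {σ : Type*} [Fintype σ]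

/-- **Parameter counting** (Kollár 2015, Lemma 10 (1), affine form, any number of variables):
if `m (d + 1) < C(d + n, n)`, `n = |σ|`, then for any `m` parametrized lines of `𝔽ⁿ` there is a
nonzero polynomial of total degree `≤ d` containing all of them. (`C(d+n, n)` is the dimension
of the space of polynomials of degree `≤ d`; containing a line is `d + 1` linear conditions.)
[cite: Kollar2015, Lemma 10 (1)] -/
theorem exists_mvPolynomial_vanishing_on_lines (L : Finset ((σ → F) × (σ → F))) (d : ℕ)
    (hcount : L.card * (d + 1) < (d + Fintype.card σ).choose (Fintype.card σ)) :
    ∃ P : MvPolynomial σ F, P ≠ 0 ∧ P.totalDegree ≤ d ∧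
      ∀ l ∈ L, MvPolynomial.aeval
        (fun i => Polynomial.C (l.1 i) + Polynomial.C (l.2 i) * Polynomial.X) P = 0 := by
  classical
  -- the space `V` of polynomials of total degree `≤ d`
  set V : Submodule F (MvPolynomial σ F) := MvPolynomial.restrictTotalDegree σ F d with hV
  -- a linearly independent family in `V` of size `C(d+n, n)`: the monomials `X^e`, `|e| ≤ d`,
  -- indexed by the exponents `f : Option σ →₀ ℕ` with `∑ f = d` (`e = f ∘ some`)
  set A : Finset (Option σ →₀ ℕ) := (Finset.univ : Finset (Option σ)).finsuppAntidiag d with hA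
  have hAsum : ∀ f ∈ A, f none + (f.some.sum fun _ e => e) = d := by
    intro f hf
    rw [hA, Finset.mem_finsuppAntidiag] at hf
    rw [← hf.1, ← Finsupp.sum_fintype f (fun _ e => e) (fun _ => rfl)]
    exact (Finsupp.sum_option_index f (fun _ e => e) (fun _ => rfl) (fun _ _ _ => rfl)).symm
  have hmem : ∀ f ∈ A, MvPolynomial.monomial f.some (1 : F) ∈ V := by
    intro f hf
    rw [hV, MvPolynomial.mem_restrictTotalDegree]
    refine (MvPolynomial.totalDegree_monomial_le _ _).trans ?_
    have := hAsum f hf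
    change (f.some.sum fun _ e => e) ≤ d
    omega
  let b : ↥A → V := fun f => ⟨MvPolynomial.monomial f.1.some 1, hmem f.1 f.2⟩
  have hinj : Function.Injective fun f : ↥A => f.1.some := by
    intro f g h
    apply Subtype.ext
    ext o
    rcases o with _ | i
    · have hf := hAsum f.1 f.2
      have hg := hAsum g.1 g.2
      simp only at h
      rw [h] at hf
      omega
    · simpa only [Finsupp.some_apply] using DFunLike.congr_fun h i
  have hli : LinearIndependent F b := by
    refine LinearIndependent.of_comp V.subtype ?_
    have : (V.subtype ∘ b) = (MvPolynomial.basisMonomials σ F) ∘ fun f : ↥A => f.1.some := by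
      funext f
      simp [b, MvPolynomial.coe_basisMonomials]
    rw [this]
    exact (MvPolynomial.basisMonomials σ F).linearIndependent.comp _ hinj
  have hcardA : Fintype.card ↥A = (d + Fintype.card σ).choose (Fintype.card σ) := by
    rw [Fintype.card_coe, hA, Finset.card_finsuppAntidiag_nat_eq_choose, Finset.card_univ,
      Fintype.card_option, show Fintype.card σ + 1 + d - 1 = d + Fintype.card σ by omega,
      Nat.choose_symm_add]
  have hVrank : (d + Fintype.card σ).choose (Fintype.card σ) ≤ Module.finrank F V := by
    rw [← hcardA]
    exact hli.fintype_card_le_finrank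
  -- the `m (d+1)` linear conditions: the first `d + 1` coefficients of each restriction
  let Ψ : V →ₗ[F] (↥L → Fin (d + 1) → F) :=
    LinearMap.pi fun l : ↥L =>
      (LinearMap.pi fun i : Fin (d + 1) =>
        (Polynomial.lcoeff F (i : ℕ)).comp
          (MvPolynomial.aeval fun i =>
            Polynomial.C (l.1.1 i) + Polynomial.C (l.1.2 i) * Polynomial.X).toLinearMap).comp
      V.subtype
  have hWrank : Module.finrank F (↥L → Fin (d + 1) → F) = L.card * (d + 1) := by
    rw [Module.finrank_pi_fintype, Finset.sum_const, Finset.card_univ, Fintype.card_coe,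
      Module.finrank_fin_fun, smul_eq_mul]
  have hlt : Module.finrank F (↥L → Fin (d + 1) → F) < Module.finrank F V :=
    hWrank ▸ hcount.trans_le hVrank
  obtain ⟨P, hPker, hP0⟩ :=
    (Submodule.ne_bot_iff _).1 (LinearMap.ker_ne_bot_of_finrank_lt (f := Ψ) hlt)
  refine ⟨P.1, fun h => hP0 (Subtype.ext h), (MvPolynomial.mem_restrictTotalDegree _ _ _).1 P.2,
    fun l hl => ?_⟩
  have hΨ : Ψ P = 0 := LinearMap.mem_ker.1 hPker
  refine Polynomial.ext fun i => ?_
  rw [Polynomial.coeff_zero]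
  by_cases hi : i < d + 1
  · have := congr_fun (congr_fun hΨ ⟨l, hl⟩) ⟨i, hi⟩
    simpa [Ψ] using this
  · refine Polynomial.coeff_eq_zero_of_natDegree_lt ?_
    refine (natDegree_aeval_line_le _ _ _).trans_lt ?_
    have := (MvPolynomial.mem_restrictTotalDegree _ _ _).1 P.2
    omega

/-- **Kollár 2015, Lemma 10 (1)** (affine form): any `m` lines of `𝔽³` lie on a surface
`{P = 0}`, `P ≠ 0`, of degree `d ≤ ⌊√(6m)⌋` — for this `d`, `(d+3)(d+2) > 6m`, i.e. the printed
count `C(d+3, 3) > m(d+1)`. [cite: Kollar2015, Lemma 10 (1)] -/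
theorem exists_surface_through_lines (L : Finset ((Fin 3 → F) × (Fin 3 → F))) :
    ∃ P : MvPolynomial (Fin 3) F, P ≠ 0 ∧ P.totalDegree ≤ Nat.sqrt (6 * L.card) ∧
      ∀ l ∈ L, MvPolynomial.aeval
        (fun i => Polynomial.C (l.1 i) + Polynomial.C (l.2 i) * Polynomial.X) P = 0 := by
  refine exists_mvPolynomial_vanishing_on_lines L (Nat.sqrt (6 * L.card)) ?_
  set m := L.card with hm
  set d := Nat.sqrt (6 * m) with hd
  have hsq : 6 * m < (d + 1) * (d + 1) := Nat.lt_succ_sqrt (6 * m)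
  have h1 := Nat.add_one_mul_choose_eq (d + 2) 2
  have h2 := Nat.add_one_mul_choose_eq (d + 1) 1
  rw [Nat.choose_one_right] at h2
  have h3 : (d + 3).choose 3 * 6 = (d + 3) * (d + 2) * (d + 1) := by
    have e1 : d + 2 + 1 = d + 3 := rfl
    have e2 : d + 1 + 1 = d + 2 := rfl
    rw [e1] at h1
    rw [e2] at h2
    calc (d + 3).choose 3 * 6 = (d + 3).choose (2 + 1) * (2 + 1) * 2 := by ring
      _ = (d + 3) * (d + 2).choose 2 * 2 := by rw [← h1]
      _ = (d + 3) * ((d + 2).choose (1 + 1) * (1 + 1)) := by ring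
      _ = (d + 3) * ((d + 2) * (d + 1)) := by rw [← h2]
      _ = (d + 3) * (d + 2) * (d + 1) := by ring
  rw [Fintype.card_fin]
  nlinarith [hsq, h3, Nat.zero_le d, Nat.zero_le m]

end Interpolation

end Literature.Combinatorics.Extremal
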